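import Mathlib.Algebra.Module.ZMod
import Mathlib.LinearAlgebra.Charpoly.BaseChange
import Mathlib.LinearAlgebra.Charpoly.ToMatrix
import Mathlib.LinearAlgebra.Dimension.OrzechProperty
import Mathlib.LinearAlgebra.Matrix.Charpoly.Basic
import Literature.NumberTheory.EllipticCurves.GaloisAction
import Literature.NumberTheory.EllipticCurves.TateModuleRank
import Literature.NumberTheory.DiophantineGeometry.AVGaloisModuleTateRankProofs
import Literature.AlgebraicGeometry.Motives.AbelianVarietyTorsionPointsCountProofs
import HarnessLib

/-!
# The mod-`ℓ` representation `A[ℓ]` is the reduction of the `ℓ`-adic one `T_ℓ A`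
# (characteristic polynomials), for abelian varieties of any dimension

Topic `NumberTheory/DiophantineGeometry`; a `…Proofs` file (theorems only: no definition, no named
fact, no `sorry`), sibling of `AVGaloisModule` / `AVGaloisModuleTateRankProofs`, landed by the seat
of the named fact
`Literature.NumberTheory.DiophantineGeometry.bcgp_switch_exists_modular_abelianSurface`
(Boxer–Calegari–Gee–Pilloni 2025, arXiv:2502.20645, Lemma 9.4.2 + Thm. 8.3.2) as the one step of
its printed proof that lives entirely in the tree's vocabulary: the bookkeeping
"`T₃(B)^∨ / 3 = B[3]^∨ = ρ̄_{B,3}`" (loc. cit. §1.8.11) by which conclusion (2)(a)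
"`ρ̄_{B,3} ≅ ρ̄`" of Lemma 9.4.2 yields the characteristic-polynomial congruence clause of the
tree's statement (see `BcgpSwitchExistsModularAbelianSurfaceProofs`).

## Mathematics (Serre–Tate 1968, §1; Mumford, *Abelian Varieties*, §18–§19; Silverman *AEC* III.§7)

For an abelian group `A` with an action of a monoid `G` by group automorphisms and a prime `p`
with `#A[pⁿ] = p^{dn}` for all `n` (for `A = B(K̄)`, `B/K` an abelian variety, `p ≠ char K`,
`d = 2 dim B`: Mumford §6, Application 3), the Tate module `T_p A = lim← A[pⁿ]` is `ℤ_p`-free of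
rank `d` (tree: `Literature.NumberTheory.EllipticCurves.TateModule.nonempty_linearEquiv_of_card_torsionBy`)
and the first projection `T_p A → A[p]` is onto (`proj_surjective_of_card`) with kernel
`p T_p A`, so `T_p A / p ≅ A[p]` `G`-equivariantly.  Consequently, for every `g ∈ G`:

* `toMatrix_torsionBy_smul_eq_map` — in the `𝔽_p`-basis of `A[p]` obtained by reducing a
  `ℤ_p`-basis of `T_p A` (`exists_basis_torsionBy_coe_eq_proj`), the matrix of `g` on `A[p]` is the
  reduction mod `p` of the matrix of `g` on `T_p A`;
* `charpoly_frame_torsionBy_eq_map_charpoly_tateRepresentation` — for ANY additive frame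
  `e : A[p] ≃ (ℤ/p)^d` in which `g` acts through a matrix `ρ̄(g)` (`e (g • P) = ρ̄(g) · e(P)`, the
  shape of the tree's `WeierstrassCurve.IsTorsionGaloisRep`), `charpoly ρ̄(g)` is the reduction
  mod `p` of `charpoly (g | T_p A)`;
* `charpoly_rationalTateRepresentation_eq_map`, `charpoly_toMatrix_rationalTateRepresentation_eq_map`
  — `charpoly (g | V_p A) = charpoly (g | T_p A)` viewed in `ℚ_p[X]` (`V_p = ℚ_p ⊗ T_p`, Mathlib
  `LinearMap.charpoly_baseChange`), in particular in ANY `ℚ_p`-basis of `V_p A` the characteristic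
  polynomial of the matrix of `g` has coefficients in `ℤ_p` and reduces mod `p` to `charpoly ρ̄(g)`.

The abelian-variety specialisations (`Literature.AlgebraicGeometry.Motives.AbelianVariety.…`, any
dimension, any prime `ℓ` invertible in the ground field, unconditional via the tree's theorem
`natCard_torsionPoints_of_isAlgClosed_holds`, Mumford §6 Application 3 from the Theorem of the
Cube) are `natCard_geomTorsion_pow'`, `charpoly_torsionFrame_eq_map_charpoly_tateRep`,
`charpoly_rationalTateRep_eq_map`, `charpoly_toMatrix_rationalTateRep_eq_map` and the combined
`exists_charpoly_toMatrix_rationalTateRep_eq_map_and_map_eq_charpoly_torsionFrame`.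
The elliptic-curve case (`d = 2`) of the framed statement is the tree's
`WeierstrassCurve.IsTorsionGaloisRep.charpoly_eq_map_charpoly_galoisRepTate`
(`Automorphic/BCDTModularityModPProofs`), whose hands-on `Fin 2` proof is replaced here by a
basis argument valid in every rank.

## References

* J.-P. Serre, J. Tate, *Good reduction of abelian varieties*, Ann. of Math. 88 (1968), §1
  (`T_ℓ(A)`, `V_ℓ(A)`, `A_ℓ = T_ℓ/ℓT_ℓ`). [SerreTate1968]
* D. Mumford, *Abelian Varieties* (1970), §6 Application 3, §18–§19. [MumfordAV1970]
* J. H. Silverman, *The Arithmetic of Elliptic Curves*, 2nd ed., III.§7. [SilvermanAEC2009]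
* G. Boxer, F. Calegari, T. Gee, V. Pilloni, *Modularity theorems for abelian surfaces*,
  arXiv:2502.20645 (2025), §1.8.11. [BoxerCalegariGeePilloni2025]

## Design

Pure theorems; `noncomputable section`; the `ZMod p`-module structure on `A[p]` is Mathlib's
`AddSubgroup.torsionBy.zmodModule` inside proofs, while the two statements that mention an
`𝔽_p`-basis of `A[p]` are made for an arbitrary `[Module (ZMod p) A[p]]` (all such structures
coincide, `c • x = c.val • x`; no local or global instance is declared); the `G`-action
on `A[n]` is the tree's instance `Literature.NumberTheory.EllipticCurves.AddSubgroup.torsionBy.instDistribMulAction`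
(`GaloisAction`).  Two private lemmas identify `toZModPow 1` with `toZMod` (copies of
`PadicInt.ringHom_eq_toZMod` / `cast_toZModPow_one` of `BCDTModularityModPProofs`, not imported to
keep this file light).  Axioms: `propext`, `Classical.choice`, `Quot.sound`.
-/

noncomputable section

open scoped TensorProduct AddSubgroup Matrix
open Module

universe u v

namespace Literature.NumberTheory.DiophantineGeometry

/-! ## Reduction `ℤ_p → 𝔽_p` through `toZModPow 1` -/

section PadicGlue

variable {p : ℕ} [Fact p.Prime]

/-- Every ring homomorphism `ℤ_[p] →+* ZMod p` is `PadicInt.toZMod` (its kernel is a proper ideal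
containing `p`, hence the maximal ideal). Copy of `PadicInt.ringHom_eq_toZMod`
(`BCDTModularityModPProofs`). [folklore] -/
private theorem ringHom_padicInt_eq_toZMod (φ : ℤ_[p] →+* ZMod p) : φ = PadicInt.toZMod := by
  apply ZMod.ringHom_eq_of_ker_eq
  rw [PadicInt.ker_toZMod]
  refine ((IsLocalRing.maximalIdeal.isMaximal ℤ_[p]).eq_of_le (RingHom.ker_ne_top φ) ?_).symm
  rw [PadicInt.maximalIdeal_eq_span_p, Ideal.span_le, Set.singleton_subset_iff, SetLike.mem_coe,
    RingHom.mem_ker, map_natCast, ZMod.natCast_self]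

/-- `((x mod p¹).val : ZMod p) = x mod p` for `x ∈ ℤ_[p]`. [folklore] -/
private theorem natCast_val_toZModPow_one (x : ℤ_[p]) :
    ((PadicInt.toZModPow 1 x).val : ZMod p) = PadicInt.toZMod x := by
  have h := ringHom_padicInt_eq_toZMod
    ((ZMod.castHom (dvd_pow_self p one_ne_zero) (ZMod p)).comp (PadicInt.toZModPow 1))
  rw [ZMod.natCast_val]
  exact (RingHom.congr_fun h x :)

end PadicGlue

/-! ## Generic Tate modules: `T_p A / p = A[p]` on matrices and characteristic polynomials -/

section Generic

open Literature.NumberTheory.EllipticCurves Literature.NumberTheory.EllipticCurves.TateModule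

variable {A : Type u} [AddCommGroup A] {p : ℕ} [Fact p.Prime] {d : ℕ}

/-- Components of an element of `T_p A` written in a `ℤ_p`-basis `b`:
`x_n = Σ_i ((b.repr x)_i mod pⁿ) • (b_i)_n` (Silverman, *AEC*, III.§7). [folklore] -/
theorem tateModule_proj_eq_sum_repr {ι : Type*} [Fintype ι] (b : Basis ι ℤ_[p] (TateModule A p))
    (x : TateModule A p) (n : ℕ) :
    proj p n x = ∑ i, (PadicInt.toZModPow n (b.repr x i)).val • proj p n (b i) := by
  conv_lhs => rw [← b.sum_repr x]
  rw [map_sum]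
  exact Finset.sum_congr rfl fun i _ ↦ proj_smul _ _ _

/-- **A `ℤ_p`-basis of `T_p A` reduces to an `𝔽_p`-basis of `A[p]`** (`T_p A / p T_p A = A[p]`,
Serre–Tate 1968, §1; Silverman, *AEC*, III.§7): if `#A[pⁿ] = p^{dn}` for all `n` and `b` is a
`ℤ_p`-basis of `T_p A` indexed by `Fin d`, the first components `(b_i)_1 ∈ A[p]` form an
`𝔽_p`-basis of `A[p]` — they span because `T_p A → A[p]` is onto (`proj_surjective_of_card`), and
`#A[p] = p^d`.  Stated for any `ZMod p`-module structure on `A[p]` (all agree with Mathlib's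
`AddSubgroup.torsionBy.zmodModule`: `c • x = c.val • x`). [cite: SerreTate1968, §1] -/
theorem exists_basis_torsionBy_coe_eq_proj [Module (ZMod p) (A[(p : ℕ)])]
    (hcard : ∀ n, Nat.card (A[(p ^ n : ℕ)]) = p ^ (d * n))
    (b : Basis (Fin d) ℤ_[p] (TateModule A p)) :
    ∃ β : Basis (Fin d) (ZMod p) (A[(p : ℕ)]), ∀ i, (β i : A) = proj p 1 (b i) := by
  have hp : p.Prime := Fact.out
  haveI : Finite (A[(p : ℕ)]) := by simpa using finite_torsionBy_of_card hcard 1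
  have hmem : ∀ a : TateModule A p, proj p 1 a ∈ A[(p : ℕ)] := fun a ↦ by
    have h := proj_mem_torsionBy 1 a
    rwa [pow_one] at h
  let P : Fin d → A[(p : ℕ)] := fun i ↦ ⟨proj p 1 (b i), hmem (b i)⟩
  have hspan : ⊤ ≤ Submodule.span (ZMod p) (Set.range P) := by
    rintro ⟨x, hx⟩ -
    obtain ⟨a, ha⟩ := proj_surjective_of_card hcard 1 (x := x) (by simpa using hx)
    have hxP : (⟨x, hx⟩ : A[(p : ℕ)]) =
        ∑ i, ((PadicInt.toZModPow 1 (b.repr a i)).val : ZMod p) • P i := by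
      apply Subtype.ext
      change x = ((∑ i, ((PadicInt.toZModPow 1 (b.repr a i)).val : ZMod p) • P i :
        A[(p : ℕ)]) : A)
      rw [AddSubmonoidClass.coe_finsetSum, ← ha, tateModule_proj_eq_sum_repr b a 1]
      refine Finset.sum_congr rfl fun i _ ↦ ?_
      rw [Nat.cast_smul_eq_nsmul, AddSubmonoidClass.coe_nsmul]
    rw [hxP]
    exact Submodule.sum_mem _ fun i _ ↦
      Submodule.smul_mem _ _ (Submodule.subset_span (Set.mem_range_self i))
  have hrank : Module.finrank (ZMod p) (A[(p : ℕ)]) = d := by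
    have h := Module.natCard_eq_pow_finrank (K := ZMod p) (V := A[(p : ℕ)])
    rw [Nat.card_zmod, card_torsionBy_one_of_card hcard] at h
    exact (Nat.pow_right_injective hp.two_le h).symm
  have hli : LinearIndependent (ZMod p) P :=
    linearIndependent_of_top_le_span_of_card_eq_finrank hspan (by rw [Fintype.card_fin, hrank])
  exact ⟨Basis.mk hli hspan, fun i ↦ by rw [Basis.mk_apply]⟩

variable {G : Type v} [Monoid G] [DistribMulAction G A]

/-- **The matrix of `g` on `A[p]` is the matrix of `g` on `T_p A` reduced mod `p`** (Serre–Tate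
1968, §1: `A_ℓ = T_ℓ/ℓT_ℓ` as `G`-modules; Silverman, *AEC*, III.§7).  Here `b` is any `ℤ_p`-basis
of `T_p A`, `β` the `𝔽_p`-basis of `A[p]` with `β_i = (b_i)_1` (`exists_basis_torsionBy_coe_eq_proj`),
`g` acts on `A[p]` through the restricted action (an `𝔽_p`-linear map, Mathlib
`AddMonoidHom.toZModLinearMap`) and on `T_p A` through `tateRepresentation`; any `ZMod p`-module
structure on `A[p]`. [cite: SerreTate1968, §1] -/
theorem toMatrix_torsionBy_smul_eq_map [Module (ZMod p) (A[(p : ℕ)])]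
    (b : Basis (Fin d) ℤ_[p] (TateModule A p))
    (β : Basis (Fin d) (ZMod p) (A[(p : ℕ)])) (hβ : ∀ i, (β i : A) = proj p 1 (b i)) (g : G) :
    LinearMap.toMatrix β β ((DistribSMul.toAddMonoidHom (A[(p : ℕ)]) g).toZModLinearMap p) =
      (LinearMap.toMatrix b b (tateRepresentation G A p g)).map PadicInt.toZMod := by
  ext i j
  rw [Matrix.map_apply, LinearMap.toMatrix_apply, LinearMap.toMatrix_apply]
  have hcol : ((DistribSMul.toAddMonoidHom (A[(p : ℕ)]) g).toZModLinearMap p) (β j) =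
      ∑ k, PadicInt.toZMod (b.repr (tateRepresentation G A p g (b j)) k) • β k := by
    apply Subtype.ext
    rw [AddMonoidHom.coe_toZModLinearMap, DistribSMul.toAddMonoidHom_apply,
      AddSubgroup.torsionBy.coe_smul, hβ j, ← proj_smul_of_distribMulAction,
      ← tateRepresentation_apply_apply (G := G) (A := A) (p := p) g (b j),
      tateModule_proj_eq_sum_repr b _ 1, AddSubmonoidClass.coe_finsetSum]
    refine Finset.sum_congr rfl fun k _ ↦ ?_
    rw [← natCast_val_toZModPow_one, Nat.cast_smul_eq_nsmul, AddSubmonoidClass.coe_nsmul, hβ k]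
  rw [hcol, Basis.repr_sum_self]

/-- **`charpoly (g | A[p]) = charpoly (g | T_p A) mod p`, framed form** (Serre–Tate 1968, §1;
Silverman, *AEC*, III.§7: "the `ℓ`-adic representation reduces to the mod-`ℓ` one").  For an
abelian group `A` with `G`-action and `#A[pⁿ] = p^{dn}` for all `n`, any additive frame
`e : A[p] ≃ (ℤ/p)^d` and any matrix-valued `ρ̄` on `G` with `e (g • P) = ρ̄(g) · e(P)`:
`charpoly ρ̄(g) ∈ 𝔽_p[X]` is the reduction of `charpoly (g | T_p A) ∈ ℤ_p[X]` (`T_p A` is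
`ℤ_p`-free of rank `d`).  Proof: `ρ̄(g)` is the matrix of `g` in the basis `e⁻¹(δ_k)` of `A[p]`,
hence has the same characteristic polynomial as the matrix of `g` in the reduction `β` of a
`ℤ_p`-basis `b` of `T_p A` (`toMatrix_torsionBy_smul_eq_map`, Mathlib `LinearMap.charpoly_toMatrix`,
`Matrix.charpoly_map`). [cite: SerreTate1968, §1] -/
theorem charpoly_frame_torsionBy_eq_map_charpoly_tateRepresentation
    (hcard : ∀ n, Nat.card (A[(p ^ n : ℕ)]) = p ^ (d * n))
    (e : A[(p : ℕ)] ≃+ (Fin d → ZMod p)) (ρ : G → Matrix (Fin d) (Fin d) (ZMod p))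
    (he : ∀ (g : G) (P : A[(p : ℕ)]), e (g • P) = ρ g *ᵥ e P) (g : G) :
    haveI := free_of_card_torsionBy_rank hcard
    haveI := finite_of_card_torsionBy_rank hcard
    (ρ g).charpoly = (tateRepresentation G A p g).charpoly.map PadicInt.toZMod := by
  haveI := free_of_card_torsionBy_rank hcard
  haveI := finite_of_card_torsionBy_rank hcard
  letI : Module (ZMod p) (A[(p : ℕ)]) := AddSubgroup.torsionBy.zmodModule
  haveI : Finite (A[(p : ℕ)]) := by simpa using finite_torsionBy_of_card hcard 1
  let b : Basis (Fin d) ℤ_[p] (TateModule A p) :=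
    Module.finBasisOfFinrankEq ℤ_[p] (TateModule A p) (finrank_eq_of_card_torsionBy hcard)
  obtain ⟨β, hβ⟩ := exists_basis_torsionBy_coe_eq_proj hcard b
  -- the frame as an `𝔽_p`-linear equivalence and the corresponding basis of `A[p]`
  let eₗ : A[(p : ℕ)] ≃ₗ[ZMod p] (Fin d → ZMod p) := { e with map_smul' := ZMod.map_smul e }
  let β' : Basis (Fin d) (ZMod p) (A[(p : ℕ)]) := (Pi.basisFun (ZMod p) (Fin d)).map eₗ.symm
  set f : A[(p : ℕ)] →ₗ[ZMod p] A[(p : ℕ)] :=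
    (DistribSMul.toAddMonoidHom (A[(p : ℕ)]) g).toZModLinearMap p with hf
  have hρ : ρ g = LinearMap.toMatrix β' β' f := by
    ext i j
    rw [LinearMap.toMatrix_apply, Basis.map_repr, LinearEquiv.trans_apply, LinearEquiv.symm_symm,
      Pi.basisFun_repr, Basis.map_apply, Pi.basisFun_apply, hf, AddMonoidHom.coe_toZModLinearMap,
      DistribSMul.toAddMonoidHom_apply]
    change ρ g i j = e (g • e.symm (Pi.single j 1)) i
    rw [he, AddEquiv.apply_symm_apply, Matrix.mulVec_single_one, Matrix.col_apply]
  rw [hρ, LinearMap.charpoly_toMatrix, ← LinearMap.charpoly_toMatrix f β,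
    toMatrix_torsionBy_smul_eq_map b β hβ g, Matrix.charpoly_map, LinearMap.charpoly_toMatrix]

/-- **`charpoly (g | V_p A) = charpoly (g | T_p A)` in `ℚ_p[X]`** (`V_p A = ℚ_p ⊗_{ℤ_p} T_p A`,
Serre–Tate 1968, §1): for `T_p A` free of finite rank over `ℤ_p` (e.g. under `#A[pⁿ] = p^{dn}`),
the characteristic polynomial of `g` on the rational Tate module is the image of the one on the
Tate module (Mathlib `LinearMap.charpoly_baseChange`; `rationalTateRepresentation g` is
`(tateRepresentation g).baseChange ℚ_p` by definition).  In particular its coefficients lie in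
`ℤ_p`. [cite: SerreTate1968, §1] -/
theorem charpoly_rationalTateRepresentation_eq_map [Module.Free ℤ_[p] (TateModule A p)]
    [Module.Finite ℤ_[p] (TateModule A p)] [Module.Finite ℚ_[p] (RationalTateModule A p)] (g : G) :
    (rationalTateRepresentation G A p g).charpoly =
      (tateRepresentation G A p g).charpoly.map (algebraMap ℤ_[p] ℚ_[p]) := by
  rw [← LinearMap.charpoly_baseChange]
  rfl

/-- **In ANY `ℚ_p`-basis of `V_p A`, `det (X - [g]) = charpoly (g | T_p A)` viewed in `ℚ_p[X]`**
(the characteristic polynomial does not depend on the basis, Mathlib `LinearMap.charpoly_toMatrix`;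
then `charpoly_rationalTateRepresentation_eq_map`).  Serre–Tate 1968, §1. [cite: SerreTate1968, §1] -/
theorem charpoly_toMatrix_rationalTateRepresentation_eq_map [Module.Free ℤ_[p] (TateModule A p)]
    [Module.Finite ℤ_[p] (TateModule A p)] [Module.Finite ℚ_[p] (RationalTateModule A p)]
    {ι : Type*} [Fintype ι] [DecidableEq ι] (c : Basis ι ℚ_[p] (RationalTateModule A p)) (g : G) :
    (LinearMap.toMatrix c c (rationalTateRepresentation G A p g)).charpoly =
      (tateRepresentation G A p g).charpoly.map (algebraMap ℤ_[p] ℚ_[p]) := by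
  rw [LinearMap.charpoly_toMatrix, charpoly_rationalTateRepresentation_eq_map]

/-- **Integrality and reduction of `charpoly (g | V_p A)` in any `ℚ_p`-basis, combined** (Serre–Tate
1968, §1; the bookkeeping "`T_p/p = A[p]`" of Boxer–Calegari–Gee–Pilloni 2025, §1.8.11): under
`#A[pⁿ] = p^{dn}`, for any additive frame `e` of `A[p]` with matrices `ρ̄(g)` and any `ℚ_p`-basis
`c` of `V_p A`, the polynomial `P = charpoly (g | T_p A) ∈ ℤ_p[X]` maps to `det (X - [g]_c)` in
`ℚ_p[X]` and reduces mod `p` to `charpoly ρ̄(g)`. [cite: SerreTate1968, §1] -/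
theorem exists_charpoly_toMatrix_eq_map_and_map_eq_charpoly_frame
    (hcard : ∀ n, Nat.card (A[(p ^ n : ℕ)]) = p ^ (d * n))
    (e : A[(p : ℕ)] ≃+ (Fin d → ZMod p)) (ρ : G → Matrix (Fin d) (Fin d) (ZMod p))
    (he : ∀ (g : G) (P : A[(p : ℕ)]), e (g • P) = ρ g *ᵥ e P)
    {ι : Type*} [Fintype ι] [DecidableEq ι] (c : Basis ι ℚ_[p] (RationalTateModule A p)) (g : G) :
    ∃ P : Polynomial ℤ_[p],
      P.map (algebraMap ℤ_[p] ℚ_[p]) =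
          (LinearMap.toMatrix c c (rationalTateRepresentation G A p g)).charpoly ∧
        P.map PadicInt.toZMod = (ρ g).charpoly := by
  haveI := free_of_card_torsionBy_rank hcard
  haveI := finite_of_card_torsionBy_rank hcard
  haveI := RationalTateModule.finite_of_card_torsionBy_rank hcard
  exact ⟨(tateRepresentation G A p g).charpoly,
    (charpoly_toMatrix_rationalTateRepresentation_eq_map c g).symm,
    (charpoly_frame_torsionBy_eq_map_charpoly_tateRepresentation hcard e ρ he g).symm⟩

end Generic

/-! ## Abelian varieties -/

section AbelianVariety

open Literature.AlgebraicGeometry.Motives (AbelianVariety)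
open Literature.AlgebraicGeometry.Motives.AbelianVariety
open Literature.NumberTheory.EllipticCurves

variable {K : Type u} [Field K] (B : AbelianVariety K) (ℓ : ℕ)

/-- **`#B[ℓⁿ](K̄) = ℓ^{2 dim B · n}` for `ℓ` invertible in `K`, unconditionally** (Mumford,
*Abelian Varieties*, §6, Application 3; Serre–Tate 1968, §1): `natCard_geomTorsion_pow` fed with
the tree's theorem `natCard_torsionPoints_of_isAlgClosed_holds`.
[cite: MumfordAV1970, §6 Application 3 (Proposition p. 64)] -/
theorem _root_.Literature.AlgebraicGeometry.Motives.AbelianVariety.natCard_geomTorsion_pow'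
    (hℓ : (ℓ : K) ≠ 0) (n : ℕ) :
    Nat.card (B.geomTorsion (ℓ ^ n : ℕ)) = ℓ ^ (2 * B.dim * n) :=
  B.natCard_geomTorsion_pow ℓ (natCard_torsionPoints_of_isAlgClosed_holds B _) hℓ n

variable [Fact ℓ.Prime]

/-- **`ρ̄_{B,ℓ} = ρ_{B,ℓ} mod ℓ` on characteristic polynomials, for an abelian variety `B/K` of any
dimension and a prime `ℓ` invertible in `K`** (Serre–Tate 1968, §1: `B[ℓ] = T_ℓ B / ℓ T_ℓ B` as
Galois modules; Mumford §18–§19): for any additive frame `e : B[ℓ](K̄) ≃ (ℤ/ℓ)^d`, `d = 2 dim B`,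
in which `Γ_K` acts through matrices `ρ̄(σ)` (`e (σ • P) = ρ̄(σ) · e(P)`), and every `σ ∈ Γ_K`,
`charpoly ρ̄(σ)` is the reduction mod `ℓ` of `charpoly (σ | T_ℓ B)` (`B.tateRep ℓ`; `T_ℓ B` is free
of rank `2 dim B`, `module_free_tateModule_holds`, `finrank_tateModule_eq_holds`).
[cite: SerreTate1968, §1] -/
theorem _root_.Literature.AlgebraicGeometry.Motives.AbelianVariety.charpoly_torsionFrame_eq_map_charpoly_tateRep
    (hℓ : (ℓ : K) ≠ 0) {d : ℕ} (hd : 2 * B.dim = d)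
    (e : B.geomTorsion (ℓ : ℕ) ≃+ (Fin d → ZMod ℓ))
    (ρ : Field.absoluteGaloisGroup K → Matrix (Fin d) (Fin d) (ZMod ℓ))
    (he : ∀ (σ : Field.absoluteGaloisGroup K) (P : B.geomTorsion (ℓ : ℕ)), e (σ • P) = ρ σ *ᵥ e P)
    [Module.Free ℤ_[ℓ] (B.tateModule ℓ)] [Module.Finite ℤ_[ℓ] (B.tateModule ℓ)]
    (σ : Field.absoluteGaloisGroup K) :
    (ρ σ).charpoly = (B.tateRep ℓ σ).charpoly.map PadicInt.toZMod := by
  have hcard : ∀ n, Nat.card ((B.geomPoints)[(ℓ ^ n : ℕ)]) = ℓ ^ (d * n) := fun n ↦ by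
    rw [← hd]; exact B.natCard_geomTorsion_pow' ℓ hℓ n
  exact charpoly_frame_torsionBy_eq_map_charpoly_tateRepresentation hcard e ρ he σ

/-- **`charpoly (σ | V_ℓ B) = charpoly (σ | T_ℓ B)` in `ℚ_ℓ[X]`** for an abelian variety `B/K`,
a prime `ℓ` invertible in `K` and `σ ∈ Γ_K` (Serre–Tate 1968, §1, `V_ℓ = T_ℓ ⊗ ℚ_ℓ`; Mumford §19,
p. 172): the `ℓ`-adic characteristic polynomials of `B` have coefficients in `ℤ_ℓ`.
[cite: SerreTate1968, §1] -/
theorem _root_.Literature.AlgebraicGeometry.Motives.AbelianVariety.charpoly_rationalTateRep_eq_map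
    [Module.Free ℤ_[ℓ] (B.tateModule ℓ)] [Module.Finite ℤ_[ℓ] (B.tateModule ℓ)]
    [Module.Finite ℚ_[ℓ] (B.rationalTateModule ℓ)] (σ : Field.absoluteGaloisGroup K) :
    (B.rationalTateRep ℓ σ).charpoly = (B.tateRep ℓ σ).charpoly.map (algebraMap ℤ_[ℓ] ℚ_[ℓ]) :=
  charpoly_rationalTateRepresentation_eq_map σ

/-- **In any `ℚ_ℓ`-basis `c` of `V_ℓ B`, `det (X - [σ]_c) = charpoly (σ | T_ℓ B)` in `ℚ_ℓ[X]`**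
(abelian variety `B/K`, prime `ℓ` invertible in `K`, `σ ∈ Γ_K`; Serre–Tate 1968, §1).
[cite: SerreTate1968, §1] -/
theorem _root_.Literature.AlgebraicGeometry.Motives.AbelianVariety.charpoly_toMatrix_rationalTateRep_eq_map
    [Module.Free ℤ_[ℓ] (B.tateModule ℓ)] [Module.Finite ℤ_[ℓ] (B.tateModule ℓ)]
    [Module.Finite ℚ_[ℓ] (B.rationalTateModule ℓ)] {ι : Type*} [Fintype ι] [DecidableEq ι]
    (c : Basis ι ℚ_[ℓ] (B.rationalTateModule ℓ)) (σ : Field.absoluteGaloisGroup K) :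
    (LinearMap.toMatrix c c (B.rationalTateRep ℓ σ)).charpoly =
      (B.tateRep ℓ σ).charpoly.map (algebraMap ℤ_[ℓ] ℚ_[ℓ]) :=
  charpoly_toMatrix_rationalTateRepresentation_eq_map c σ

/-- **Integrality and reduction of the `ℓ`-adic characteristic polynomials of an abelian variety,
combined** (Serre–Tate 1968, §1; Boxer–Calegari–Gee–Pilloni 2025, §1.8.11, "`T_p/p = A[p]`"):
for `B/K` an abelian variety, `ℓ` a prime invertible in `K`, an additive frame `e` of `B[ℓ](K̄)`
(`d = 2 dim B`) with matrices `ρ̄(σ)`, any `ℚ_ℓ`-basis `c` of `V_ℓ B` and any `σ ∈ Γ_K`, there is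
`P ∈ ℤ_ℓ[X]` (namely `charpoly (σ | T_ℓ B)`) with `P = det (X - [σ]_c)` in `ℚ_ℓ[X]` and
`P mod ℓ = charpoly ρ̄(σ)`.  Unconditional (no instance hypotheses). [cite: SerreTate1968, §1] -/
theorem _root_.Literature.AlgebraicGeometry.Motives.AbelianVariety.exists_charpoly_toMatrix_rationalTateRep_eq_map_and_map_eq_charpoly_torsionFrame
    (hℓ : (ℓ : K) ≠ 0) {d : ℕ} (hd : 2 * B.dim = d)
    (e : B.geomTorsion (ℓ : ℕ) ≃+ (Fin d → ZMod ℓ))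
    (ρ : Field.absoluteGaloisGroup K → Matrix (Fin d) (Fin d) (ZMod ℓ))
    (he : ∀ (σ : Field.absoluteGaloisGroup K) (P : B.geomTorsion (ℓ : ℕ)), e (σ • P) = ρ σ *ᵥ e P)
    {ι : Type*} [Fintype ι] [DecidableEq ι] (c : Basis ι ℚ_[ℓ] (B.rationalTateModule ℓ))
    (σ : Field.absoluteGaloisGroup K) :
    ∃ P : Polynomial ℤ_[ℓ],
      P.map (algebraMap ℤ_[ℓ] ℚ_[ℓ]) = (LinearMap.toMatrix c c (B.rationalTateRep ℓ σ)).charpoly ∧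
        P.map PadicInt.toZMod = (ρ σ).charpoly := by
  have hcard : ∀ n, Nat.card ((B.geomPoints)[(ℓ ^ n : ℕ)]) = ℓ ^ (d * n) := fun n ↦ by
    rw [← hd]; exact B.natCard_geomTorsion_pow' ℓ hℓ n
  exact exists_charpoly_toMatrix_eq_map_and_map_eq_charpoly_frame hcard e ρ he c σ

end AbelianVariety

end Literature.NumberTheory.DiophantineGeometry

end
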